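import Literature.MathematicalPhysics.QuantumLattice.FermiRG.BGM2003SectorPropagatorDecayMaster
import Literature.Analysis.Fourier.FourierDecayFromDerivBounds
import Mathlib.Analysis.Calculus.ParametricIntegral
import HarnessLib

/-!
# Benfatto–Giuliani–Mastropietro 2003, Lemma 2.1 [lm3.1] (3.22) — proof, part 3: derivatives under the integral,
# the anisotropic change of variables, and the discharge `lemma21_sectorPropagatorDecay_holds`

Topic `Literature/MathematicalPhysics/QuantumLattice/FermiRG`; concludes `BGM2003SectorPropagatorDecayFrame.lean` and
`BGM2003SectorPropagatorDecayMaster.lean` (seat t3).  Source: G. Benfatto, A. Giuliani, V. Mastropietro, Ann. Henri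
Poincaré 4 (2003) 137–193, arXiv:cond-mat/0207210 [BenfattoGiulianiMastropietro2003], §2.3 Lemma 2.1 (3.22) p.8
(L57–63) and its proof §7.2 p.27 (L28–52) («by using simple integration by parts arguments … a change of
variables, well defined on the support of `F_{h,ω}`»).

* §A **Derivatives under the integral.**  For an oscillatory integral
  `Φ_w(x₀,x₁,x₂) = ∫ e^{-i(ℓ₀(p)x₀ + ℓ₁(p)x₁ + ℓ₂(p)x₂)} w(p) dp` over `ℝ × ℝ²` with `w` continuous of compact support
  and `ℓᵢ` continuous (`BGM2003.oscInt`), the nested iterated derivatives of F3c's `mixedPartial` are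
  `∂₀^{n₀}∂₁^{n₁}∂₂^{n₂}Φ_w = Φ_{(−iℓ₀)^{n₀}(−iℓ₁)^{n₁}(−iℓ₂)^{n₂} w}` (dominated differentiation,
  `hasDerivAt_integral_of_dominated_loc_of_deriv_le`); and F3c's `sectorPropagatorFrame` IS such an integral with
  `ℓ = (k₀, k'₁, k'₂)` and `w = (2π)^{-3} S₀` (`wSymbol` of part 2 at `α = 0`), so
  `mixedPartial n₀ n₁ n₂ (sectorPropagatorFrame …) = Φ_{(2π)^{-3} S_α}`.
* §B **The change of variables** `k = q_F + A t`, `A = (4^{-n}, 4^{-n}n⃗, 2^{-n}τ⃗)` (`chartCLE`, `det A = γ^{5h/2}`,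
  adjoint = the dual scales), `Φ = e^{ic} 𝓕(S_α ∘ split)` at the dual point, `S_α ∘ split = R_α ∘ A⁻¹ ∘ (· − q_F)`
  with `R_α` the rescaled weighted symbol of part 2 — the tree's `SectorPropagatorFourier` for the abstract frame.
* §C **Assembly**: part 2's `h`-uniform bounds + `Analysis/Fourier/FourierDecayFromDerivBounds` +
  `Analysis/Fourier/FourierLinearChange` give
  `|∂^α g^{(h)}_ω(x)| ≤ C 4^{-n(3/2+n₀+n₁+n₂/2)} / (1 + (4^{-n}|x₀| + 4^{-n}|x'₁| + 2^{-n}|x'₂|)^N)`, i.e.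
  **`theorem lemma21_sectorPropagatorDecay_holds : lemma21_sectorPropagatorDecay`** (D-0014 discharge of the named
  fact F-013 of the cell's FACT-LIST; net debt −1).

Everything here is PROVED; no named fact is introduced (D-0026); F3a–F3d are untouched.
-/

noncomputable section

open Real Set Complex Function Filter MeasureTheory Metric
open scoped Topology ContDiff ComplexConjugate FourierTransform InnerProductSpace ENNReal
open Literature.Analysis.Calculus Literature.Analysis.SpecialFunctions Literature.Analysis.Fourier

namespace Literature.MathematicalPhysics.QuantumLattice.FermiRG

namespace BGM2003

variable {ε : (Fin 2 → ℝ) → ℝ} {μ e₀ : ℝ} {u : ℝ → ℝ → ℝ}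

/-! ### §A. Oscillatory integrals over `ℝ × ℝ²` and their derivatives -/

/-- Phase space `ℝ_{k₀} × ℝ²_{k⃗}` of F3c's integrals. [cite: BenfattoGiulianiMastropietro2003, §2.3 (3.20) p.8 (L10–16)] -/
abbrev Phase : Type := ℝ × (Fin 2 → ℝ)

/-- **The oscillatory integral** `Φ_w(x₀,x₁,x₂) = ∫ e^{-i(ℓ₀(p)x₀ + ℓ₁(p)x₁ + ℓ₂(p)x₂)} w(p) dp`.
[cite: BenfattoGiulianiMastropietro2003, §2.3 (3.20c) p.8 (L43–48)] -/
def oscInt (ℓ₀ ℓ₁ ℓ₂ : Phase → ℝ) (w : Phase → ℂ) (x₀ x₁ x₂ : ℝ) : ℂ :=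
  ∫ p : Phase, exp (-(I * ((ℓ₀ p * x₀ + ℓ₁ p * x₁ + ℓ₂ p * x₂ : ℝ) : ℂ))) * w p

/-- `‖e^{-ir}‖ = 1`. [cite: BenfattoGiulianiMastropietro2003, §2.3 (3.20) p.8 (L10–16)] -/
theorem norm_exp_neg_I_mul (r : ℝ) : ‖exp (-(I * (r : ℂ)))‖ = 1 := by
  rw [show -(I * (r : ℂ)) = ((-r : ℝ) : ℂ) * I by push_cast; ring, Complex.norm_exp_ofReal_mul_I]

/-- Cyclic symmetry of `Φ` in its three variables. [cite: BenfattoGiulianiMastropietro2003, §2.3 (3.20c) p.8 (L43–48)] -/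
theorem oscInt_rot (ℓ₀ ℓ₁ ℓ₂ : Phase → ℝ) (w : Phase → ℂ) (x₀ x₁ x₂ : ℝ) :
    oscInt ℓ₀ ℓ₁ ℓ₂ w x₀ x₁ x₂ = oscInt ℓ₂ ℓ₀ ℓ₁ w x₂ x₀ x₁ := by
  unfold oscInt
  congr 1; funext p
  rw [show ℓ₀ p * x₀ + ℓ₁ p * x₁ + ℓ₂ p * x₂ = ℓ₂ p * x₂ + ℓ₀ p * x₀ + ℓ₁ p * x₁ by ring]

/-- **Differentiation under the integral sign in the first variable**:
`∂_{x₀} Φ_w = Φ_{(−iℓ₀)w}` for `w` continuous with compact support. [cite: BenfattoGiulianiMastropietro2003, §7.2 p.27 (L28–52)] -/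
theorem hasDerivAt_oscInt {ℓ₀ ℓ₁ ℓ₂ : Phase → ℝ} (hℓ₀ : Continuous ℓ₀) (hℓ₁ : Continuous ℓ₁) (hℓ₂ : Continuous ℓ₂)
    {w : Phase → ℂ} (hw : Continuous w) (hws : HasCompactSupport w) (x₀ x₁ x₂ : ℝ) :
    HasDerivAt (fun y => oscInt ℓ₀ ℓ₁ ℓ₂ w y x₁ x₂)
      (oscInt ℓ₀ ℓ₁ ℓ₂ (fun p => -(I * (ℓ₀ p : ℂ)) * w p) x₀ x₁ x₂) x₀ := by
  -- a bound for `ℓ₀` on the support of `w`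
  obtain ⟨L, hL⟩ := hws.isCompact.exists_bound_of_continuousOn (hℓ₀.continuousOn (s := tsupport w))
  set F : ℝ → Phase → ℂ := fun y p => exp (-(I * ((ℓ₀ p * y + ℓ₁ p * x₁ + ℓ₂ p * x₂ : ℝ) : ℂ))) * w p with hF
  set F' : ℝ → Phase → ℂ := fun y p =>
    exp (-(I * ((ℓ₀ p * y + ℓ₁ p * x₁ + ℓ₂ p * x₂ : ℝ) : ℂ))) * -(I * ((ℓ₀ p * 1 : ℝ) : ℂ)) * w p with hF'
  have hphase : ∀ y : ℝ, Continuous fun p : Phase => exp (-(I * ((ℓ₀ p * y + ℓ₁ p * x₁ + ℓ₂ p * x₂ : ℝ) : ℂ))) := by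
    intro y
    refine Complex.continuous_exp.comp (Continuous.neg (continuous_const.mul (Complex.continuous_ofReal.comp ?_)))
    exact ((hℓ₀.mul continuous_const).add (hℓ₁.mul continuous_const)).add (hℓ₂.mul continuous_const)
  have hFcont : ∀ y, Continuous (F y) := fun y => (hphase y).mul hw
  have hF'cont : ∀ y, Continuous (F' y) := fun y =>
    ((hphase y).mul ((continuous_const.mul (Complex.continuous_ofReal.comp (hℓ₀.mul continuous_const))).neg)).mul hw
  have hFsupp : ∀ y, HasCompactSupport (F y) := fun y => hws.mul_left
  have h := hasDerivAt_integral_of_dominated_loc_of_deriv_le (μ := volume) (F := F) (F' := F') (x₀ := x₀)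
    (bound := fun p => ‖L‖ * ‖w p‖) (s := univ) univ_mem
    (Eventually.of_forall fun y => (hFcont y).aestronglyMeasurable)
    ((hFcont x₀).integrable_of_hasCompactSupport (hFsupp x₀))
    (hF'cont x₀).aestronglyMeasurable ?_ ?_ ?_
  · -- conclusion
    have heq : (fun y => oscInt ℓ₀ ℓ₁ ℓ₂ w y x₁ x₂) = fun y => ∫ p, F y p := by funext y; rfl
    rw [heq]
    have heq' : oscInt ℓ₀ ℓ₁ ℓ₂ (fun p => -(I * (ℓ₀ p : ℂ)) * w p) x₀ x₁ x₂ = ∫ p, F' x₀ p := by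
      unfold oscInt; congr 1; funext p; simp only [hF', mul_one]; ring
    rw [heq']
    exact h.2
  · -- the bound `‖F' y p‖ ≤ |L| ‖w p‖`
    refine Eventually.of_forall fun p y _ => ?_
    have hnorm : ‖F' y p‖ = |ℓ₀ p| * ‖w p‖ := by
      simp only [hF', norm_mul, norm_neg, norm_exp_neg_I_mul, one_mul, Complex.norm_I, Complex.norm_real,
        Real.norm_eq_abs, mul_one]
    rw [hnorm]
    by_cases hp : p ∈ tsupport w
    · have h1 : |ℓ₀ p| ≤ ‖L‖ := (hL p hp).trans (le_abs_self L)
      exact mul_le_mul_of_nonneg_right h1 (norm_nonneg _)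
    · rw [image_eq_zero_of_notMem_tsupport hp, norm_zero, mul_zero, mul_zero]
  · exact (hw.norm.const_mul _).integrable_of_hasCompactSupport hws.norm.mul_left
  · -- the pointwise derivative
    refine Eventually.of_forall fun p y _ => ?_
    have h1 : HasDerivAt (fun y : ℝ => ℓ₀ p * y + ℓ₁ p * x₁ + ℓ₂ p * x₂) (ℓ₀ p * 1) y := by
      simpa using (((hasDerivAt_id y).const_mul (ℓ₀ p)).add_const (ℓ₁ p * x₁)).add_const (ℓ₂ p * x₂)
    have h2 : HasDerivAt (fun y : ℝ => -(I * ((ℓ₀ p * y + ℓ₁ p * x₁ + ℓ₂ p * x₂ : ℝ) : ℂ)))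
        (-(I * ((ℓ₀ p * 1 : ℝ) : ℂ))) y := (h1.ofReal_comp.const_mul I).neg
    have h3 := ((Complex.hasDerivAt_exp _).comp y h2).mul_const (w p)
    simpa [hF, hF'] using h3

/-- `(−iℓ₀) w` is again continuous with compact support, so the previous lemma iterates. [cite: BenfattoGiulianiMastropietro2003, §7.2 p.27 (L28–52)] -/
theorem continuous_weight_mul {ℓ : Phase → ℝ} (hℓ : Continuous ℓ) {w : Phase → ℂ} (hw : Continuous w) (m : ℕ) :
    Continuous fun p => (-(I * (ℓ p : ℂ))) ^ m * w p :=
  ((continuous_const.mul (Complex.continuous_ofReal.comp hℓ)).neg.pow m).mul hw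

/-- **All orders in the first variable**: `∂_{x₀}^m Φ_w = Φ_{(−iℓ₀)^m w}`. [cite: BenfattoGiulianiMastropietro2003, §7.2 p.27 (L28–52)] -/
theorem iteratedDeriv_oscInt {ℓ₀ ℓ₁ ℓ₂ : Phase → ℝ} (hℓ₀ : Continuous ℓ₀) (hℓ₁ : Continuous ℓ₁) (hℓ₂ : Continuous ℓ₂)
    (m : ℕ) {w : Phase → ℂ} (hw : Continuous w) (hws : HasCompactSupport w) (x₀ x₁ x₂ : ℝ) :
    iteratedDeriv m (fun y => oscInt ℓ₀ ℓ₁ ℓ₂ w y x₁ x₂) x₀ =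
      oscInt ℓ₀ ℓ₁ ℓ₂ (fun p => (-(I * (ℓ₀ p : ℂ))) ^ m * w p) x₀ x₁ x₂ := by
  induction m generalizing w x₀ with
  | zero => simp
  | succ m ih =>
    rw [iteratedDeriv_succ']
    have hderiv : deriv (fun y => oscInt ℓ₀ ℓ₁ ℓ₂ w y x₁ x₂) =
        fun y => oscInt ℓ₀ ℓ₁ ℓ₂ (fun p => -(I * (ℓ₀ p : ℂ)) * w p) y x₁ x₂ := by
      funext y
      exact (hasDerivAt_oscInt hℓ₀ hℓ₁ hℓ₂ hw hws y x₁ x₂).deriv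
    rw [hderiv]
    have hw' : Continuous fun p => -(I * (ℓ₀ p : ℂ)) * w p :=
      ((continuous_const.mul (Complex.continuous_ofReal.comp hℓ₀)).neg).mul hw
    have hws' : HasCompactSupport fun p => -(I * (ℓ₀ p : ℂ)) * w p := hws.mul_left
    rw [ih hw' hws' x₀]
    unfold oscInt
    congr 1; funext p
    simp only [pow_succ]
    ring

/-- **Mixed partials under the integral**: for `w` continuous with compact support,
`∂_{x₀}^{n₀}∂_{x₁}^{n₁}∂_{x₂}^{n₂} Φ_w = Φ_{(−iℓ₀)^{n₀}(−iℓ₁)^{n₁}(−iℓ₂)^{n₂} w}` (F3c's nested `mixedPartial`).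
[cite: BenfattoGiulianiMastropietro2003, §2.3 Lemma 2.1 (3.22) p.8 (L57–63) and §7.2 p.27 (L28–52)] -/
theorem mixedPartial_oscInt {ℓ₀ ℓ₁ ℓ₂ : Phase → ℝ} (hℓ₀ : Continuous ℓ₀) (hℓ₁ : Continuous ℓ₁) (hℓ₂ : Continuous ℓ₂)
    {w : Phase → ℂ} (hw : Continuous w) (hws : HasCompactSupport w) (n₀ n₁ n₂ : ℕ) (x₀ x₁ x₂ : ℝ) :
    mixedPartial n₀ n₁ n₂ (oscInt ℓ₀ ℓ₁ ℓ₂ w) x₀ x₁ x₂ =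
      oscInt ℓ₀ ℓ₁ ℓ₂ (fun p => (-(I * (ℓ₀ p : ℂ))) ^ n₀ * ((-(I * (ℓ₁ p : ℂ))) ^ n₁ *
        ((-(I * (ℓ₂ p : ℂ))) ^ n₂ * w p))) x₀ x₁ x₂ := by
  -- weights after the `x₂`- and `x₁`-derivatives
  set w₂ : Phase → ℂ := fun p => (-(I * (ℓ₂ p : ℂ))) ^ n₂ * w p with hw₂
  set w₁ : Phase → ℂ := fun p => (-(I * (ℓ₁ p : ℂ))) ^ n₁ * w₂ p with hw₁
  have hw₂c : Continuous w₂ := continuous_weight_mul hℓ₂ hw n₂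
  have hw₂s : HasCompactSupport w₂ := hws.mul_left
  have hw₁c : Continuous w₁ := continuous_weight_mul hℓ₁ hw₂c n₁
  have hw₁s : HasCompactSupport w₁ := hw₂s.mul_left
  -- innermost: derivatives in `x₂`
  have h2 : ∀ t s : ℝ, iteratedDeriv n₂ (fun r => oscInt ℓ₀ ℓ₁ ℓ₂ w t s r) x₂ = oscInt ℓ₀ ℓ₁ ℓ₂ w₂ t s x₂ := by
    intro t s
    have hrot : (fun r => oscInt ℓ₀ ℓ₁ ℓ₂ w t s r) = fun r => oscInt ℓ₂ ℓ₀ ℓ₁ w r t s := by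
      funext r; exact oscInt_rot ℓ₀ ℓ₁ ℓ₂ w t s r
    rw [hrot, iteratedDeriv_oscInt hℓ₂ hℓ₀ hℓ₁ n₂ hw hws x₂ t s, oscInt_rot ℓ₀ ℓ₁ ℓ₂ w₂ t s x₂]
  -- middle: derivatives in `x₁`
  have h1 : ∀ t : ℝ, iteratedDeriv n₁ (fun s => oscInt ℓ₀ ℓ₁ ℓ₂ w₂ t s x₂) x₁ = oscInt ℓ₀ ℓ₁ ℓ₂ w₁ t x₁ x₂ := by
    intro t
    have hrot : (fun s => oscInt ℓ₀ ℓ₁ ℓ₂ w₂ t s x₂) = fun s => oscInt ℓ₁ ℓ₂ ℓ₀ w₂ s x₂ t := by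
      funext s
      rw [oscInt_rot ℓ₀ ℓ₁ ℓ₂ w₂ t s x₂, oscInt_rot ℓ₂ ℓ₀ ℓ₁ w₂ x₂ t s]
    rw [hrot, iteratedDeriv_oscInt hℓ₁ hℓ₂ hℓ₀ n₁ hw₂c hw₂s x₁ x₂ t, oscInt_rot ℓ₁ ℓ₂ ℓ₀ w₁ x₁ x₂ t,
      oscInt_rot ℓ₀ ℓ₁ ℓ₂ w₁ t x₁ x₂, oscInt_rot ℓ₂ ℓ₀ ℓ₁ w₁ x₂ t x₁]
  -- outermost: derivatives in `x₀`
  unfold mixedPartial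
  simp_rw [h2, h1]
  rw [iteratedDeriv_oscInt hℓ₀ hℓ₁ hℓ₂ n₀ hw₁c hw₁s x₀ x₁ x₂]

/-! ### §A'. F3c's sector propagator in the frame is an oscillatory integral of the weighted symbol -/

/-- The complex constant `(2π)^{-3}` of (3.20). [cite: BenfattoGiulianiMastropietro2003, §2.3 (3.20) p.8 (L10–16)] -/
def invTwoPiCube : ℂ := ((((2 * π) ^ 3 : ℝ) : ℂ))⁻¹

/-- `‖(2π)^{-3}‖ = ((2π)³)⁻¹`. [cite: BenfattoGiulianiMastropietro2003, §2.3 (3.20) p.8 (L10–16)] -/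
theorem norm_invTwoPiCube : ‖invTwoPiCube‖ = ((2 * π) ^ 3)⁻¹ := by
  rw [invTwoPiCube, norm_inv, Complex.norm_real, Real.norm_eq_abs, abs_of_pos (by positivity)]

/-- **`g^{(h)}_ω` in the frame (3.21b) is the oscillatory integral `Φ_{(2π)^{-3}S₀}` with phases `k₀, k'₁, k'₂`**:
`e^{-i(k₀x₀ + (k⃗ − p⃗_F)·(x'₁n⃗ + x'₂τ⃗))} = e^{-i(k₀x₀ + k'₁x'₁ + k'₂x'₂)}`. [cite: BenfattoGiulianiMastropietro2003, §2.3 (3.20c), (3.21b) p.8 (L43–51)] -/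
theorem sectorPropagatorFrame_eq_oscInt (ε : (Fin 2 → ℝ) → ℝ) (μ e₀ : ℝ) (u : ℝ → ℝ → ℝ) (n σ : ℕ)
    (x₀ x₁ x₂ : ℝ) :
    sectorPropagatorFrame ε μ e₀ u n σ x₀ x₁ x₂ =
      oscInt (fun p => p.1) (fun p => frameCoord₁ u (sectorCenter n σ) p.2)
        (fun p => frameCoord₂ u (sectorCenter n σ) p.2)
        (fun p => invTwoPiCube * wSymbol ε μ e₀ u n σ 0 0 0 p) x₀ x₁ x₂ := by
  unfold sectorPropagatorFrame sectorPropagator oscInt invTwoPiCube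
  rw [← integral_const_mul]
  congr 1; funext p
  have hphase : p.1 * x₀ + ∑ i : Fin 2, (p.2 i - fermiPoint u (sectorCenter n σ) i) *
        (x₁ • unitNormal u (sectorCenter n σ) 0 + x₂ • unitTangent u (sectorCenter n σ) 0) i =
      p.1 * x₀ + frameCoord₁ u (sectorCenter n σ) p.2 * x₁ + frameCoord₂ u (sectorCenter n σ) p.2 * x₂ := by
    simp only [frameCoord₁, frameCoord₂, Fin.sum_univ_two, Pi.add_apply, Pi.smul_apply, smul_eq_mul]
    ring
  rw [hphase]
  simp only [wSymbol, pow_zero, one_mul]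
  ring

/-- The general oscillatory integral `Φ_{(2π)^{-3}S_α}` as the mixed partial derivative of `g^{(h)}_ω` in the frame —
valid once `S_α` is known to be continuous with compact support (§B). [cite: BenfattoGiulianiMastropietro2003, §2.3 Lemma 2.1 (3.22) p.8 (L57–63)] -/
theorem mixedPartial_sectorPropagatorFrame (ε : (Fin 2 → ℝ) → ℝ) (μ e₀ : ℝ) (u : ℝ → ℝ → ℝ) (n σ n₀ n₁ n₂ : ℕ)
    (hW : Continuous fun p : Phase => wSymbol ε μ e₀ u n σ 0 0 0 p)
    (hWs : HasCompactSupport fun p : Phase => wSymbol ε μ e₀ u n σ 0 0 0 p)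
    (hℓ₁ : Continuous fun p : Phase => frameCoord₁ u (sectorCenter n σ) p.2)
    (hℓ₂ : Continuous fun p : Phase => frameCoord₂ u (sectorCenter n σ) p.2) (x₀ x₁ x₂ : ℝ) :
    mixedPartial n₀ n₁ n₂ (sectorPropagatorFrame ε μ e₀ u n σ) x₀ x₁ x₂ =
      oscInt (fun p => p.1) (fun p => frameCoord₁ u (sectorCenter n σ) p.2)
        (fun p => frameCoord₂ u (sectorCenter n σ) p.2)
        (fun p => invTwoPiCube * wSymbol ε μ e₀ u n σ n₀ n₁ n₂ p) x₀ x₁ x₂ := by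
  have hfun : sectorPropagatorFrame ε μ e₀ u n σ =
      oscInt (fun p => p.1) (fun p => frameCoord₁ u (sectorCenter n σ) p.2)
        (fun p => frameCoord₂ u (sectorCenter n σ) p.2) (fun p => invTwoPiCube * wSymbol ε μ e₀ u n σ 0 0 0 p) := by
    funext a b c; exact sectorPropagatorFrame_eq_oscInt ε μ e₀ u n σ a b c
  have hWc : Continuous fun p : Phase => invTwoPiCube * wSymbol ε μ e₀ u n σ 0 0 0 p := continuous_const.mul hW
  have hWcs : HasCompactSupport fun p : Phase => invTwoPiCube * wSymbol ε μ e₀ u n σ 0 0 0 p := hWs.mul_left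
  rw [hfun, mixedPartial_oscInt continuous_fst hℓ₁ hℓ₂ hWc hWcs n₀ n₁ n₂ x₀ x₁ x₂]
  unfold oscInt
  congr 1; funext p
  simp only [wSymbol, pow_zero, one_mul]
  ring

/-! ### §B. The anisotropic change of variables (the tree's `SectorPropagatorFourier` for the abstract frame) -/

/-- The dual point `ξ(x₀, v⃗) = (x₀, v⃗)/(2π)` at which Mathlib's `𝓕` (kernel `e^{-2πi⟨q,ξ⟩}`) reproduces
`e^{-i(q₀x₀ + q⃗·v⃗)}`. [cite: BenfattoGiulianiMastropietro2003, §2.3 (3.20c) p.8 (L43–48)] -/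
def dualPt (x₀ : ℝ) (v : Fin 2 → ℝ) : MomSpace :=
  WithLp.toLp 2 ![x₀ / (2 * π), v 0 / (2 * π), v 1 / (2 * π)]

/-- **`Φ` is a Fourier transform**: `Φ_w(x₀,x'₁,x'₂) = e^{ic} 𝓕(w ∘ split)(ξ(x₀, x'₁n⃗ + x'₂τ⃗))` with the constant
phase `c = x'₁ p⃗_F·n⃗ + x'₂ p⃗_F·τ⃗` (the extracted quasi-particle phase of (3.20)).
[cite: BenfattoGiulianiMastropietro2003, §2.3 (3.20)–(3.20c) p.8 (L10–48)] -/
theorem oscInt_eq_fourier (u : ℝ → ℝ → ℝ) (θ₀ : ℝ) (w : Phase → ℂ) (x₀ x₁ x₂ : ℝ) :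
    oscInt (fun p => p.1) (fun p => frameCoord₁ u θ₀ p.2) (fun p => frameCoord₂ u θ₀ p.2) w x₀ x₁ x₂ =
      exp (I * ((x₁ * ∑ i : Fin 2, fermiPoint u θ₀ i * unitNormal u θ₀ 0 i +
          x₂ * ∑ i : Fin 2, fermiPoint u θ₀ i * unitTangent u θ₀ 0 i : ℝ) : ℂ)) *
        𝓕 (fun q : MomSpace => w (splitMomentum q))
          (dualPt x₀ (x₁ • unitNormal u θ₀ 0 + x₂ • unitTangent u θ₀ 0)) := by
  rw [Real.fourier_eq', ← integral_const_mul, oscInt,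
    ← measurePreserving_splitMomentum.integral_comp splitMomentum.measurableEmbedding]
  refine integral_congr_ae (ae_of_all _ fun q => ?_)
  simp only [splitMomentum_apply, smul_eq_mul]
  rw [← mul_assoc, ← Complex.exp_add]
  congr 1
  congr 1
  rw [inner_E3]
  simp only [dualPt, PiLp.toLp_apply, Matrix.cons_val_zero, Matrix.cons_val_one, Matrix.cons_val_two,
    Matrix.tail_cons, Matrix.head_cons, frameCoord₁, frameCoord₂, Fin.sum_univ_two, Pi.add_apply, Pi.smul_apply,
    smul_eq_mul]
  push_cast
  field_simp
  ring

/-- The matrix of the chart `t ↦ (4^{-n}t₀, 4^{-n}t₁n⃗(θ₀) + 2^{-n}t₂τ⃗(θ₀))`. [cite: BenfattoGiulianiMastropietro2003, §2.3 (3.21a) p.8 (L36–41)] -/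
def chartMatrix (u : ℝ → ℝ → ℝ) (θ₀ : ℝ) (n : ℕ) : Matrix (Fin 3) (Fin 3) ℝ :=
  !![(4 : ℝ) ^ (-(n : ℤ)), 0, 0;
     0, (4 : ℝ) ^ (-(n : ℤ)) * unitNormal u θ₀ 0 0, (2 : ℝ) ^ (-(n : ℤ)) * unitTangent u θ₀ 0 0;
     0, (4 : ℝ) ^ (-(n : ℤ)) * unitNormal u θ₀ 0 1, (2 : ℝ) ^ (-(n : ℤ)) * unitTangent u θ₀ 0 1]

/-- `det = 4^{-n}·4^{-n}·2^{-n}` (the frame is orthonormal and positively oriented): the `γ^hγ^hγ^{h/2}` volume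
of a sector. [cite: BenfattoGiulianiMastropietro2003, §2.3 (3.21a)–(3.22) p.8 (L36–63)] -/
theorem DispersionHyp.det_chartMatrix (hD : DispersionHyp ε μ e₀ u) (θ₀ : ℝ) (n : ℕ) :
    (chartMatrix u θ₀ n).det = (4 : ℝ) ^ (-(n : ℤ)) * (4 : ℝ) ^ (-(n : ℤ)) * (2 : ℝ) ^ (-(n : ℤ)) := by
  have he : |(0 : ℝ)| ≤ e₀ := by rw [abs_zero]; exact hD.e₀_pos.le
  have hframe := hD.unitNormal_cross_unitTangent θ₀ he
  rw [chartMatrix, Matrix.det_fin_three]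
  simp only [Matrix.of_apply, Matrix.cons_val', Matrix.cons_val_zero, Matrix.cons_val_one,
    Matrix.cons_val_two, Matrix.empty_val', Matrix.cons_val_fin_one, Matrix.head_cons, Matrix.tail_cons,
    Matrix.head_fin_const]
  linear_combination ((4 : ℝ) ^ (-(n : ℤ)) * (4 : ℝ) ^ (-(n : ℤ)) * (2 : ℝ) ^ (-(n : ℤ))) * hframe

/-- The chart as a linear map of `ℝ³`. [cite: BenfattoGiulianiMastropietro2003, §2.3 (3.21a) p.8 (L36–41)] -/
def chartLin (u : ℝ → ℝ → ℝ) (θ₀ : ℝ) (n : ℕ) : MomSpace →ₗ[ℝ] MomSpace := Matrix.toEuclideanLin (chartMatrix u θ₀ n)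

/-- Its determinant. [cite: BenfattoGiulianiMastropietro2003, §2.3 (3.21a) p.8 (L36–41)] -/
theorem DispersionHyp.det_chartLin (hD : DispersionHyp ε μ e₀ u) (θ₀ : ℝ) (n : ℕ) :
    LinearMap.det (chartLin u θ₀ n) = (4 : ℝ) ^ (-(n : ℤ)) * (4 : ℝ) ^ (-(n : ℤ)) * (2 : ℝ) ^ (-(n : ℤ)) := by
  rw [chartLin, Matrix.toEuclideanLin, ← hD.det_chartMatrix θ₀ n]
  exact LinearMap.det_toLpLin 2 _

/-- The determinant is nonzero. [cite: BenfattoGiulianiMastropietro2003, §2.3 (3.21a) p.8 (L36–41)] -/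
theorem DispersionHyp.det_chartLin_ne_zero (hD : DispersionHyp ε μ e₀ u) (θ₀ : ℝ) (n : ℕ) :
    LinearMap.det (chartLin u θ₀ n) ≠ 0 := by
  rw [hD.det_chartLin]; positivity

/-- **The anisotropic chart** as a continuous linear automorphism of `ℝ³`. [cite: BenfattoGiulianiMastropietro2003, §2.3 (3.21a) p.8 (L36–41) and §7.2 p.27 (L28–52)] -/
def DispersionHyp.chartCLE (hD : DispersionHyp ε μ e₀ u) (θ₀ : ℝ) (n : ℕ) : MomSpace ≃L[ℝ] MomSpace :=
  (LinearMap.equivOfDetNeZero (chartLin u θ₀ n) (hD.det_chartLin_ne_zero θ₀ n)).toContinuousLinearEquiv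

/-- The chart in coordinates. [cite: BenfattoGiulianiMastropietro2003, §2.3 (3.21a) p.8 (L36–41)] -/
theorem DispersionHyp.chartCLE_apply (hD : DispersionHyp ε μ e₀ u) (θ₀ : ℝ) (n : ℕ) (t : MomSpace) :
    hD.chartCLE θ₀ n t = WithLp.toLp 2
      ![(4 : ℝ) ^ (-(n : ℤ)) * t 0,
        (4 : ℝ) ^ (-(n : ℤ)) * unitNormal u θ₀ 0 0 * t 1 + (2 : ℝ) ^ (-(n : ℤ)) * unitTangent u θ₀ 0 0 * t 2,
        (4 : ℝ) ^ (-(n : ℤ)) * unitNormal u θ₀ 0 1 * t 1 + (2 : ℝ) ^ (-(n : ℤ)) * unitTangent u θ₀ 0 1 * t 2] := by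
  change chartLin u θ₀ n t = _
  rw [chartLin, Matrix.toEuclideanLin, Matrix.toLpLin_apply]
  congr 1
  funext i
  fin_cases i <;> simp [chartMatrix, Matrix.mulVec, dotProduct, Fin.sum_univ_three]

/-- Its determinant (through the underlying linear equivalence). [cite: BenfattoGiulianiMastropietro2003, §2.3 (3.21a) p.8 (L36–41)] -/
theorem DispersionHyp.det_chartCLE (hD : DispersionHyp ε μ e₀ u) (θ₀ : ℝ) (n : ℕ) :
    LinearMap.det ((hD.chartCLE θ₀ n : MomSpace ≃ₗ[ℝ] MomSpace) : MomSpace →ₗ[ℝ] MomSpace) =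
      (4 : ℝ) ^ (-(n : ℤ)) * (4 : ℝ) ^ (-(n : ℤ)) * (2 : ℝ) ^ (-(n : ℤ)) := by
  rw [← hD.det_chartLin θ₀ n]
  rfl

/-- The determinant of the inverse chart. [cite: BenfattoGiulianiMastropietro2003, §2.3 (3.21a) p.8 (L36–41)] -/
theorem DispersionHyp.det_chartCLE_symm (hD : DispersionHyp ε μ e₀ u) (θ₀ : ℝ) (n : ℕ) :
    LinearMap.det (((hD.chartCLE θ₀ n).symm : MomSpace ≃ₗ[ℝ] MomSpace) : MomSpace →ₗ[ℝ] MomSpace) =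
      ((4 : ℝ) ^ (-(n : ℤ)) * (4 : ℝ) ^ (-(n : ℤ)) * (2 : ℝ) ^ (-(n : ℤ)))⁻¹ := by
  rw [← hD.det_chartCLE θ₀ n]
  exact LinearEquiv.det_coe_symm _

/-- **The adjoint of the chart** (the dual scales): `w ↦ (4^{-n}w₀, 4^{-n}⟨n⃗, w⃗⟩, 2^{-n}⟨τ⃗, w⃗⟩)`.
[cite: BenfattoGiulianiMastropietro2003, §2.3 Lemma 2.1 (3.22) p.8 (L57–63)] -/
def chartAdj (u : ℝ → ℝ → ℝ) (θ₀ : ℝ) (n : ℕ) (w : MomSpace) : MomSpace :=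
  WithLp.toLp 2
    ![(4 : ℝ) ^ (-(n : ℤ)) * w 0,
      (4 : ℝ) ^ (-(n : ℤ)) * (unitNormal u θ₀ 0 0 * w 1 + unitNormal u θ₀ 0 1 * w 2),
      (2 : ℝ) ^ (-(n : ℤ)) * (unitTangent u θ₀ 0 0 * w 1 + unitTangent u θ₀ 0 1 * w 2)]

/-- `chartAdj` is the adjoint of `chartCLE`. [cite: BenfattoGiulianiMastropietro2003, §2.3 Lemma 2.1 (3.22) p.8 (L57–63)] -/
theorem DispersionHyp.adjoint_chartCLE (hD : DispersionHyp ε μ e₀ u) (θ₀ : ℝ) (n : ℕ) (w : MomSpace) :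
    ContinuousLinearMap.adjoint (hD.chartCLE θ₀ n : MomSpace →L[ℝ] MomSpace) w = chartAdj u θ₀ n w := by
  refine ext_inner_right ℝ fun t => ?_
  rw [ContinuousLinearMap.adjoint_inner_left, ContinuousLinearEquiv.coe_coe, hD.chartCLE_apply, inner_E3,
    inner_E3]
  simp only [chartAdj, PiLp.toLp_apply, Matrix.cons_val_zero, Matrix.cons_val_one, Matrix.cons_val_two,
    Matrix.tail_cons, Matrix.head_cons]
  ring

/-- **The adjoint at the dual point of the frame decomposition**: for `ξ = ξ(x₀, x'₁n⃗ + x'₂τ⃗)`,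
`A†ξ = (4^{-n}x₀, 4^{-n}x'₁, 2^{-n}x'₂)/(2π)` (orthonormality of `(n⃗, τ⃗)`). [cite: BenfattoGiulianiMastropietro2003, §2.3 Lemma 2.1 (3.22) p.8 (L57–63)] -/
theorem DispersionHyp.chartAdj_dualPt (hD : DispersionHyp ε μ e₀ u) (θ₀ : ℝ) (n : ℕ) (x₀ x₁ x₂ : ℝ) :
    chartAdj u θ₀ n (dualPt x₀ (x₁ • unitNormal u θ₀ 0 + x₂ • unitTangent u θ₀ 0)) =
      WithLp.toLp 2 ![(4 : ℝ) ^ (-(n : ℤ)) * (x₀ / (2 * π)), (4 : ℝ) ^ (-(n : ℤ)) * (x₁ / (2 * π)),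
        (2 : ℝ) ^ (-(n : ℤ)) * (x₂ / (2 * π))] := by
  have he : |(0 : ℝ)| ≤ e₀ := by rw [abs_zero]; exact hD.e₀_pos.le
  have hn := hD.unitNormal_normSq θ₀ he
  have hτ := hD.unitTangent_normSq θ₀ he
  have ht := unitNormal_dot_unitTangent u θ₀ 0
  simp only [chartAdj, dualPt, PiLp.toLp_apply, Matrix.cons_val_zero, Matrix.cons_val_one, Matrix.cons_val_two,
    Matrix.tail_cons, Matrix.head_cons, Pi.add_apply, Pi.smul_apply, smul_eq_mul]
  congr 1
  funext i
  fin_cases i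
  · rfl
  · simp only [Fin.mk_one, Matrix.cons_val_one, Matrix.cons_val_zero]
    field_simp
    linear_combination x₁ * hn + x₂ * ht
  · simp only [Fin.reduceFinMk, Matrix.cons_val_two, Matrix.tail_cons, Matrix.head_cons]
    field_simp
    linear_combination x₂ * hτ + x₁ * ht

/-- The base point `q_F = (0, p⃗_F(θ₀))` of the chart. [cite: BenfattoGiulianiMastropietro2003, §2.3 (3.21a) p.8 (L36–41)] -/
def basePt (u : ℝ → ℝ → ℝ) (θ₀ : ℝ) : MomSpace := WithLp.toLp 2 ![0, fermiPoint u θ₀ 0, fermiPoint u θ₀ 1]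

/-- `(2^{-n})² = 4^{-n}`. [cite: BenfattoGiulianiMastropietro2003, §2.3 p.7 (L131–133)] -/
private theorem two_zpow_neg_sq' (n : ℕ) : ((2 : ℝ) ^ (-(n : ℤ))) ^ 2 = (4 : ℝ) ^ (-(n : ℤ)) := by
  rw [← zpow_natCast, ← zpow_mul, show (4 : ℝ) = 2 ^ (2 : ℤ) by norm_num, ← zpow_mul]; congr 1; ring

/-- **The chart at scale `n`**: `q_F + A t` splits as `(4^{-n}t₀, chartPt (θ₀,t₁,t₂) 2^{-n})`. [cite: BenfattoGiulianiMastropietro2003, §2.3 (3.21a) p.8 (L36–41)] -/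
theorem DispersionHyp.split_basePt_add_chartCLE (hD : DispersionHyp ε μ e₀ u) (θ₀ : ℝ) (n : ℕ) (t : MomSpace) :
    splitMomentum (basePt u θ₀ + hD.chartCLE θ₀ n t) =
      ((4 : ℝ) ^ (-(n : ℤ)) * t 0, chartPt u (θ₀, t 1, t 2) ((2 : ℝ) ^ (-(n : ℤ)))) := by
  have h42 := two_zpow_neg_sq' n
  rw [splitMomentum_apply, hD.chartCLE_apply, basePt]
  refine Prod.ext ?_ ?_
  · simp
  · ext i
    fin_cases i
    · simp only [Fin.zero_eta, Fin.isValue, Matrix.cons_val_zero, chartPt_apply, PiLp.add_apply,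
        Matrix.cons_val_one, Matrix.cons_val_two, Matrix.tail_cons, Matrix.head_cons]
      rw [h42]; ring
    · simp only [Fin.mk_one, Fin.isValue, Matrix.cons_val_one, Matrix.cons_val_zero, chartPt_apply,
        PiLp.add_apply, Matrix.cons_val_two, Matrix.tail_cons, Matrix.head_cons]
      rw [h42]; ring

/-- **The symbol is the rescaled symbol in the chart**: `(cS_α) ∘ split = (cR_α) ∘ A⁻¹ ∘ (· − q_F)`.
[cite: BenfattoGiulianiMastropietro2003, §7.2 p.27 (L28–52)] -/
theorem DispersionHyp.wSymbolE_eq_comp (hD : DispersionHyp ε μ e₀ u) (c : ℂ) (n σ n₀ n₁ n₂ : ℕ) :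
    (fun q : MomSpace => c * wSymbol ε μ e₀ u n σ n₀ n₁ n₂ (splitMomentum q)) =
      ((fun t => c * rescaledWSymbol ε μ e₀ u n σ n₀ n₁ n₂ t) ∘ (hD.chartCLE (sectorCenter n σ) n).symm) ∘
        fun q => q + -basePt u (sectorCenter n σ) := by
  funext q
  set t : MomSpace := (hD.chartCLE (sectorCenter n σ) n).symm (q + -basePt u (sectorCenter n σ)) with ht
  simp only [Function.comp_apply, rescaledWSymbol]
  rw [← ht, ← hD.split_basePt_add_chartCLE (sectorCenter n σ) n t]
  congr 3
  rw [ht, ContinuousLinearEquiv.apply_symm_apply]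
  abel

/-- Translations act on the Fourier transform by a phase. [cite: BenfattoGiulianiMastropietro2003, §2.3 (3.20) p.8 (L10–16)] -/
private theorem norm_fourier_comp_add_right' (f : MomSpace → ℂ) (v₀ w : MomSpace) :
    ‖𝓕 (f ∘ fun v => v + v₀) w‖ = ‖𝓕 f w‖ :=
  norm_fourier_comp_add_right f v₀ w

/-- **Decay transfer (the change-of-variables half of Lemma 2.1).**  If the rescaled weighted symbol (times a constant
`c`) has Fourier decay `‖𝓕(cR_α)(y)‖ ≤ K(1+‖y‖)^{-N}`, then
`|Φ_{cS_α}(x₀,x'₁,x'₂)| ≤ 4^{-n}4^{-n}2^{-n} · K · (1 + ‖(4^{-n}x₀, 4^{-n}x'₁, 2^{-n}x'₂)‖/(2π))^{-N}`.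
[cite: BenfattoGiulianiMastropietro2003, §2.3 Lemma 2.1 (3.22) p.8 (L57–63) and §7.2 p.27 (L28–52)] -/
theorem DispersionHyp.norm_oscInt_le_of_fourier_decay (hD : DispersionHyp ε μ e₀ u) {c : ℂ} {n σ n₀ n₁ n₂ : ℕ}
    {K : ℝ} {N : ℕ} (hK : ∀ y, ‖𝓕 (fun t => c * rescaledWSymbol ε μ e₀ u n σ n₀ n₁ n₂ t) y‖ ≤ K * ((1 + ‖y‖) ^ N)⁻¹)
    (x₀ x₁ x₂ : ℝ) :
    ‖oscInt (fun p => p.1) (fun p => frameCoord₁ u (sectorCenter n σ) p.2)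
        (fun p => frameCoord₂ u (sectorCenter n σ) p.2)
        (fun p => c * wSymbol ε μ e₀ u n σ n₀ n₁ n₂ p) x₀ x₁ x₂‖ ≤
      ((4 : ℝ) ^ (-(n : ℤ)) * (4 : ℝ) ^ (-(n : ℤ)) * (2 : ℝ) ^ (-(n : ℤ))) *
        (K * ((1 + ‖WithLp.toLp 2 ![(4 : ℝ) ^ (-(n : ℤ)) * (x₀ / (2 * π)), (4 : ℝ) ^ (-(n : ℤ)) * (x₁ / (2 * π)),
          (2 : ℝ) ^ (-(n : ℤ)) * (x₂ / (2 * π))]‖) ^ N)⁻¹) := by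
  set θ₀ : ℝ := sectorCenter n σ with hθ₀
  set A := hD.chartCLE θ₀ n with hA
  rw [oscInt_eq_fourier, norm_mul, show I * _ = ((x₁ * ∑ i : Fin 2, fermiPoint u θ₀ i * unitNormal u θ₀ 0 i +
      x₂ * ∑ i : Fin 2, fermiPoint u θ₀ i * unitTangent u θ₀ 0 i : ℝ) : ℂ) * I by ring,
    Complex.norm_exp_ofReal_mul_I, one_mul, hD.wSymbolE_eq_comp c n σ n₀ n₁ n₂, norm_fourier_comp_add_right']
  have h := norm_fourier_comp_continuousLinearEquiv_le A.symm hK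
    (dualPt x₀ (x₁ • unitNormal u θ₀ 0 + x₂ • unitTangent u θ₀ 0))
  rw [ContinuousLinearEquiv.symm_symm, hD.adjoint_chartCLE, hD.chartAdj_dualPt] at h
  refine h.trans (le_of_eq ?_)
  have hdet := hD.det_chartCLE_symm θ₀ n
  rw [← hA] at hdet
  have hpos : 0 < (4 : ℝ) ^ (-(n : ℤ)) * (4 : ℝ) ^ (-(n : ℤ)) * (2 : ℝ) ^ (-(n : ℤ)) := by positivity
  have key : |(LinearMap.det ((A.symm : MomSpace ≃ₗ[ℝ] MomSpace) : MomSpace →ₗ[ℝ] MomSpace))⁻¹| =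
      (4 : ℝ) ^ (-(n : ℤ)) * (4 : ℝ) ^ (-(n : ℤ)) * (2 : ℝ) ^ (-(n : ℤ)) := by
    rw [hdet, inv_inv, abs_of_pos hpos]
  exact congrArg₂ (· * ·) key rfl

/-! ### §C. Assembly: Lemma 2.1 -/

/-- The coordinate embedding `ℝ × ℝ² → ℝ³` inverting `splitMomentum`. [cite: BenfattoGiulianiMastropietro2003, §2.3 (3.20) p.8 (L10–16)] -/
def embPhase (p : Phase) : MomSpace := WithLp.toLp 2 ![p.1, p.2 0, p.2 1]

/-- `split ∘ emb = id`. [cite: BenfattoGiulianiMastropietro2003, §2.3 (3.20) p.8 (L10–16)] -/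
theorem splitMomentum_embPhase (p : Phase) : splitMomentum (embPhase p) = p := by
  rw [embPhase, splitMomentum_apply]
  refine Prod.ext (by simp) ?_
  ext j
  fin_cases j <;> simp

/-- `emb ∘ split = id`. [cite: BenfattoGiulianiMastropietro2003, §2.3 (3.20) p.8 (L10–16)] -/
theorem embPhase_splitMomentum (q : MomSpace) : embPhase (splitMomentum q) = q := by
  rw [splitMomentum_apply, embPhase]
  ext i
  fin_cases i <;> simp

/-- `emb` is continuous. [cite: BenfattoGiulianiMastropietro2003, §2.3 (3.20) p.8 (L10–16)] -/
theorem continuous_embPhase : Continuous embPhase := by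
  unfold embPhase
  refine (PiLp.continuous_toLp 2 (fun _ : Fin 3 => ℝ)).comp (continuous_pi fun i => ?_)
  fin_cases i
  · simpa using continuous_fst
  · simpa using (continuous_apply 0).comp' continuous_snd
  · simpa using (continuous_apply 1).comp' continuous_snd

/-- `split` is continuous. [cite: BenfattoGiulianiMastropietro2003, §2.3 (3.20) p.8 (L10–16)] -/
theorem continuous_splitMomentum : Continuous (splitMomentum : MomSpace → Phase) := by
  have h : (splitMomentum : MomSpace → Phase) = fun q => (q 0, ![q 1, q 2]) := by
    funext q; exact splitMomentum_apply q
  rw [h]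
  refine (PiLp.continuous_apply 2 (fun _ : Fin 3 => ℝ) 0).prodMk (continuous_pi fun i => ?_)
  fin_cases i
  · simpa using PiLp.continuous_apply 2 (fun _ : Fin 3 => ℝ) 1
  · simpa using PiLp.continuous_apply 2 (fun _ : Fin 3 => ℝ) 2

/-- The frame coordinates are continuous functions on phase space. [cite: BenfattoGiulianiMastropietro2003, §2.3 (3.21a) p.8 (L36–41)] -/
theorem continuous_frameCoord₁ (u : ℝ → ℝ → ℝ) (θ₀ : ℝ) :
    Continuous fun p : Phase => frameCoord₁ u θ₀ p.2 := by
  simp only [frameCoord₁, Fin.sum_univ_two]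
  fun_prop

/-- The frame coordinates are continuous functions on phase space. [cite: BenfattoGiulianiMastropietro2003, §2.3 (3.21a) p.8 (L36–41)] -/
theorem continuous_frameCoord₂ (u : ℝ → ℝ → ℝ) (θ₀ : ℝ) :
    Continuous fun p : Phase => frameCoord₂ u θ₀ p.2 := by
  simp only [frameCoord₂, Fin.sum_univ_two]
  fun_prop

/-- **The weighted symbol is continuous with compact support** on `ℝ × ℝ²` (it is the smooth, box-supported rescaled
symbol of part 2 read through the affine chart). [cite: BenfattoGiulianiMastropietro2003, §7.2 p.27 (L28–52)] -/
theorem DispersionHyp.continuous_hasCompactSupport_wSymbol (hD : DispersionHyp ε μ e₀ u) {r : ℝ} (hr : 0 < r)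
    {χ : (Fin 2 → ℝ) → ℝ} (hχs : ContDiff ℝ ∞ χ) (hχ1 : ∀ k ∈ shell u e₀, χ k = 1)
    (hχr : ∀ k, χ k ≠ 0 → 2 * r ≤ ‖momToComplex k‖) (hχε : ∀ k, χ k ≠ 0 → k ∉ shell u e₀ → e₀ < |ε k - μ|)
    (n σ n₀ n₁ n₂ : ℕ) (hσ : σ < sectorCount n) :
    Continuous (fun p : Phase => wSymbol ε μ e₀ u n σ n₀ n₁ n₂ p) ∧
      HasCompactSupport (fun p : Phase => wSymbol ε μ e₀ u n σ n₀ n₁ n₂ p) := by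
  set R := rescaledWSymbol ε μ e₀ u n σ n₀ n₁ n₂ with hR
  set A := hD.chartCLE (sectorCenter n σ) n with hA
  set G : MomSpace → ℂ := (R ∘ A.symm) ∘ fun q => q + -basePt u (sectorCenter n σ) with hG
  have hcomp := hD.wSymbolE_eq_comp 1 n σ n₀ n₁ n₂
  simp only [one_mul] at hcomp
  have hWp : ∀ p : Phase, wSymbol ε μ e₀ u n σ n₀ n₁ n₂ p = G (embPhase p) := by
    intro p
    have := congrFun hcomp (embPhase p)
    rw [splitMomentum_embPhase] at this
    exact this
  have hW : (fun p : Phase => wSymbol ε μ e₀ u n σ n₀ n₁ n₂ p) = G ∘ embPhase := by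
    funext p; exact hWp p
  have hRc : Continuous R := (hD.contDiff_rescaledWSymbol hr hχs hχ1 hχr hχε n σ n₀ n₁ n₂).continuous
  have hGc : Continuous G := (hRc.comp A.symm.continuous).comp (continuous_id.add continuous_const)
  refine ⟨by rw [hW]; exact hGc.comp continuous_embPhase, ?_⟩
  -- compact support: the support of `R` lies in the box
  obtain ⟨c, hc, hbox⟩ := hD.exists_box_rescaledWSymbol
  set T : Set MomSpace := {t | |t 0| ≤ e₀ ∧ |t 1| ≤ c ∧ |t 2| ≤ c} with hT
  have hTc : IsCompact T := isCompact_momBox _ _ _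
  -- `K` = image of the box under the affine chart, read in `ℝ × ℝ²`
  set K : Set Phase := splitMomentum '' ((fun t => basePt u (sectorCenter n σ) + A t) '' T) with hK
  have hKc : IsCompact K :=
    ((hTc.image (continuous_const.add A.continuous)).image continuous_splitMomentum)
  refine HasCompactSupport.intro hKc fun p hp => ?_
  by_contra hne
  apply hp
  -- `p = split (q_F + A t)` with `t = A⁻¹(emb p − q_F)` in the box
  set t : MomSpace := A.symm (embPhase p + -basePt u (sectorCenter n σ)) with ht
  have hpt : p = splitMomentum (basePt u (sectorCenter n σ) + A t) := by
    rw [ht, ContinuousLinearEquiv.apply_symm_apply, ← add_assoc, add_neg_cancel_comm]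
    exact (splitMomentum_embPhase p).symm
  have hRt : R t ≠ 0 := by
    rw [hWp p] at hne
    exact hne
  exact ⟨basePt u (sectorCenter n σ) + A t, ⟨t, hbox n σ n₀ n₁ n₂ hσ t hRt, rfl⟩, hpt.symm⟩

/-- **The scales of (3.22)**: `γ^hγ^hγ^{h/2} · (γ^{-h}γ^{hn₀}γ^{hn₁}γ^{hn₂/2}) = γ^{h(3/2+n₀+n₁+n₂/2)}`, `γ = 4`, `h = −n`.
[cite: BenfattoGiulianiMastropietro2003, §2.3 Lemma 2.1 (3.22) p.8 (L57–63)] -/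
theorem det_mul_scaleFactor (n n₀ n₁ n₂ : ℕ) :
    (4 : ℝ) ^ (-(n : ℤ)) * (4 : ℝ) ^ (-(n : ℤ)) * (2 : ℝ) ^ (-(n : ℤ)) * scaleFactor n n₀ n₁ n₂ =
      (4 : ℝ) ^ (-((n : ℝ) * (3 / 2 + (n₀ : ℝ) + (n₁ : ℝ) + (n₂ : ℝ) / 2))) := by
  -- everything as an integer power of `2`
  have h4 : (4 : ℝ) = (2 : ℝ) ^ (2 : ℤ) := by norm_num
  have h4n : (4 : ℝ) ^ (-(n : ℤ)) = (2 : ℝ) ^ (-(2 * (n : ℤ))) := by rw [h4, ← zpow_mul]; congr 1; ring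
  have h4nn : (4 : ℝ) ^ n = (2 : ℝ) ^ ((2 * (n : ℤ))) := by rw [← zpow_natCast, h4, ← zpow_mul]
  have hL : (4 : ℝ) ^ (-(n : ℤ)) * (4 : ℝ) ^ (-(n : ℤ)) * (2 : ℝ) ^ (-(n : ℤ)) * scaleFactor n n₀ n₁ n₂ =
      (2 : ℝ) ^ (-((n : ℤ) * (3 + 2 * n₀ + 2 * n₁ + n₂))) := by
    rw [scaleFactor, h4n, h4nn, ← zpow_natCast ((2 : ℝ) ^ (-(2 * (n : ℤ)))) n₀, ← zpow_natCast ((2 : ℝ) ^ (-(2 * (n : ℤ)))) n₁,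
      ← zpow_natCast ((2 : ℝ) ^ (-(n : ℤ))) n₂, ← zpow_mul, ← zpow_mul, ← zpow_mul]
    rw [← zpow_add₀ (by norm_num : (2 : ℝ) ≠ 0), ← zpow_add₀ (by norm_num : (2 : ℝ) ≠ 0),
      ← zpow_add₀ (by norm_num : (2 : ℝ) ≠ 0), ← zpow_add₀ (by norm_num : (2 : ℝ) ≠ 0),
      ← zpow_add₀ (by norm_num : (2 : ℝ) ≠ 0), ← zpow_add₀ (by norm_num : (2 : ℝ) ≠ 0)]
    congr 1; ring
  have hR : (4 : ℝ) ^ (-((n : ℝ) * (3 / 2 + (n₀ : ℝ) + (n₁ : ℝ) + (n₂ : ℝ) / 2))) =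
      (2 : ℝ) ^ (-((n : ℤ) * (3 + 2 * n₀ + 2 * n₁ + n₂))) := by
    rw [show (4 : ℝ) = (2 : ℝ) ^ (2 : ℝ) by norm_num, ← Real.rpow_mul (by norm_num), ← Real.rpow_intCast]
    congr 1; push_cast; ring
  rw [hL, hR]

/-- The anisotropic norm of (3.22) against the Euclidean norm of the rescaled point: with
`S = 4^{-n}|x₀| + 4^{-n}|x'₁| + 2^{-n}|x'₂|` and `y = (4^{-n}x₀, 4^{-n}x'₁, 2^{-n}x'₂)/(2π)`,
`1 + S^N ≤ (1 + (6π)^N)(1 + ‖y‖)^N`. [cite: BenfattoGiulianiMastropietro2003, §2.3 Lemma 2.1 (3.22) p.8 (L57–63)] -/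
theorem one_add_pow_le (n N : ℕ) (x₀ x₁ x₂ : ℝ) :
    1 + ((4 : ℝ) ^ (-(n : ℤ)) * |x₀| + (4 : ℝ) ^ (-(n : ℤ)) * |x₁| + (2 : ℝ) ^ (-(n : ℤ)) * |x₂|) ^ N ≤
      (1 + (6 * π) ^ N) * (1 + ‖(WithLp.toLp 2 ![(4 : ℝ) ^ (-(n : ℤ)) * (x₀ / (2 * π)),
        (4 : ℝ) ^ (-(n : ℤ)) * (x₁ / (2 * π)), (2 : ℝ) ^ (-(n : ℤ)) * (x₂ / (2 * π))] : MomSpace)‖) ^ N := by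
  set y : MomSpace := WithLp.toLp 2 ![(4 : ℝ) ^ (-(n : ℤ)) * (x₀ / (2 * π)), (4 : ℝ) ^ (-(n : ℤ)) * (x₁ / (2 * π)),
    (2 : ℝ) ^ (-(n : ℤ)) * (x₂ / (2 * π))] with hy
  set S : ℝ := (4 : ℝ) ^ (-(n : ℤ)) * |x₀| + (4 : ℝ) ^ (-(n : ℤ)) * |x₁| + (2 : ℝ) ^ (-(n : ℤ)) * |x₂| with hS
  have hπ := pi_pos
  have h4 : 0 < (4 : ℝ) ^ (-(n : ℤ)) := zpow_pos (by norm_num) _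
  have h2 : 0 < (2 : ℝ) ^ (-(n : ℤ)) := zpow_pos (by norm_num) _
  have hy0 : ‖y 0‖ ≤ ‖y‖ := PiLp.norm_apply_le y 0
  have hy1 : ‖y 1‖ ≤ ‖y‖ := PiLp.norm_apply_le y 1
  have hy2 : ‖y 2‖ ≤ ‖y‖ := PiLp.norm_apply_le y 2
  simp only [hy, PiLp.toLp_apply, Matrix.cons_val_zero, Matrix.cons_val_one, Matrix.cons_val_two, Matrix.tail_cons,
    Matrix.head_cons, Real.norm_eq_abs, abs_mul, abs_of_pos h4, abs_of_pos h2, abs_div,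
    abs_of_pos (by positivity : (0 : ℝ) < 2 * π)] at hy0 hy1 hy2
  have hSle : S ≤ 6 * π * ‖y‖ := by
    rw [hS]
    have e0 : (4 : ℝ) ^ (-(n : ℤ)) * |x₀| = 2 * π * ((4 : ℝ) ^ (-(n : ℤ)) * (|x₀| / (2 * π))) := by field_simp
    have e1 : (4 : ℝ) ^ (-(n : ℤ)) * |x₁| = 2 * π * ((4 : ℝ) ^ (-(n : ℤ)) * (|x₁| / (2 * π))) := by field_simp
    have e2 : (2 : ℝ) ^ (-(n : ℤ)) * |x₂| = 2 * π * ((2 : ℝ) ^ (-(n : ℤ)) * (|x₂| / (2 * π))) := by field_simp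
    rw [e0, e1, e2]
    nlinarith
  have hS0 : 0 ≤ S := by positivity
  have hyn : 0 ≤ ‖y‖ := norm_nonneg _
  have h1 : S ^ N ≤ (6 * π) ^ N * (1 + ‖y‖) ^ N := by
    rw [← mul_pow]
    exact pow_le_pow_left₀ hS0 (hSle.trans (by nlinarith)) N
  have h2' : (1 : ℝ) ≤ (1 + ‖y‖) ^ N := one_le_pow₀ (by linarith)
  nlinarith [pow_nonneg (by positivity : (0 : ℝ) ≤ 6 * π) N]

/-- **BGM 2003 Lemma 2.1 [lm3.1], (3.22) — PROVED** (the discharge of F3c's named fact): for every datum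
`(ε, μ, e₀, u)` of the §1.2 class `DispersionHyp`, all `N, n₀, n₁, n₂`, there is `C > 0` with
`|∂_{x₀}^{n₀}∂_{x'₁}^{n₁}∂_{x'₂}^{n₂} g^{(h)}_ω(x)| ≤ C γ^{h(3/2+n₀+n₁+n₂/2)} / (1 + (γ^h|x₀| + γ^h|x'₁| + γ^{h/2}|x'₂|)^N)`
for all `h = −n ≤ 0`, `ω ∈ O_h`, `x` — by the paper's §7.2: differentiation under the integral (§A), the anisotropic
change of variables (§B, part 1's chart and part 2's master function), `h`-uniform symbol bounds by compactness
(part 2) and `N` integrations by parts (`Analysis/Fourier/FourierDecayFromDerivBounds`).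
[cite: BenfattoGiulianiMastropietro2003, §2.3 Lemma 2.1 (3.22) p.8 (L57–63) and §7.2 p.27 (L28–52)] -/
theorem lemma21_sectorPropagatorDecay_holds : lemma21_sectorPropagatorDecay := by
  intro ε μ e₀ u hD N n₀ n₁ n₂
  have he := hD.e₀_pos
  obtain ⟨δ, r, hδ, hr, hχs, hχ1, hχr, hχε⟩ := hD.exists_shellBump
  -- `h`-uniform derivative bounds of the rescaled weighted symbols, up to order `N`
  choose B hB0 hB using fun m =>
    hD.exists_norm_iteratedFDeriv_rescaledWSymbol_le hr hχs hχ1 hχr hχε n₀ n₁ n₂ m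
  set Bs : ℝ := ∑ m ∈ Finset.range (N + 1), B m with hBs
  have hBs0 : 0 ≤ Bs := Finset.sum_nonneg fun m _ => hB0 m
  have hBle : ∀ m ≤ N, B m ≤ Bs := fun m hm =>
    Finset.single_le_sum (fun k _ => hB0 k) (Finset.mem_range.2 (Nat.lt_succ_of_le hm))
  -- the box and its volume
  obtain ⟨c, hc, hbox⟩ := hD.exists_box_rescaledWSymbol
  set T : Set MomSpace := {t | |t 0| ≤ e₀ ∧ |t 1| ≤ c ∧ |t 2| ≤ c} with hT
  have hTc : IsCompact T := isCompact_momBox _ _ _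
  have hTfin : volume T < ⊤ := hTc.measure_lt_top
  set vol : ℝ := (volume T).toReal with hvol
  have hvol0 : 0 ≤ vol := ENNReal.toReal_nonneg
  set c3 : ℝ := ((2 * π) ^ 3)⁻¹ with hc3
  have hc30 : 0 < c3 := by positivity
  set C₀ : ℝ := 2 ^ N * (c3 * Bs * vol) * (1 + (6 * π) ^ N) with hC₀
  have hC₀0 : 0 ≤ C₀ := by positivity
  refine ⟨C₀ + 1, by positivity, fun n σ hσ x₀ x₁ x₂ => ?_⟩
  -- the rescaled weighted symbol of this scale/sector, times `(2π)^{-3}`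
  set R := rescaledWSymbol ε μ e₀ u n σ n₀ n₁ n₂ with hRdef
  set f : MomSpace → ℂ := fun t => invTwoPiCube * R t with hf
  have hRc : ContDiff ℝ ∞ R := hD.contDiff_rescaledWSymbol hr hχs hχ1 hχr hχε n σ n₀ n₁ n₂
  have hfc : ContDiff ℝ ∞ f := contDiff_const.mul hRc
  have hsuppR : tsupport R ⊆ T :=
    closure_minimal (fun v hv => hbox n σ n₀ n₁ n₂ hσ v hv) hTc.isClosed
  have hsuppf : tsupport f ⊆ T := tsupport_mul_subset_right.trans hsuppR
  have hfs : HasCompactSupport f := hTc.of_isClosed_subset (isClosed_tsupport _) hsuppf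
  have hSF := scaleFactor_pos n n₀ n₁ n₂
  have hM : ∀ m ≤ N, ∀ t, ‖iteratedFDeriv ℝ m f t‖ ≤ c3 * (scaleFactor n n₀ n₁ n₂ * Bs) := by
    intro m hm t
    have hder : iteratedFDeriv ℝ m f t = invTwoPiCube • iteratedFDeriv ℝ m R t := by
      have : f = fun t => invTwoPiCube • R t := by funext t; rfl
      rw [this]
      exact iteratedFDeriv_const_smul_apply' ((hRc.of_le (by exact_mod_cast le_top)).contDiffAt)
    rw [hder, norm_smul, norm_invTwoPiCube]
    refine mul_le_mul_of_nonneg_left ?_ hc30.le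
    exact (hB m n σ hσ t).trans (mul_le_mul_of_nonneg_left (hBle m hm) hSF.le)
  have hvolle : (volume (tsupport f)).toReal ≤ vol := ENNReal.toReal_mono hTfin.ne (measure_mono hsuppf)
  have hK : ∀ y, ‖𝓕 f y‖ ≤ 2 ^ N * (c3 * (scaleFactor n n₀ n₁ n₂ * Bs) * vol) * ((1 + ‖y‖) ^ N)⁻¹ := fun y =>
    norm_fourier_le_of_iteratedFDeriv_le hfc hfs hM hvolle y
  -- Step A: the mixed partial derivative is the oscillatory integral of the weighted symbol
  obtain ⟨hWc, hWs⟩ := hD.continuous_hasCompactSupport_wSymbol hr hχs hχ1 hχr hχε n σ 0 0 0 hσ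
  rw [mixedPartial_sectorPropagatorFrame ε μ e₀ u n σ n₀ n₁ n₂ hWc hWs (continuous_frameCoord₁ u _)
    (continuous_frameCoord₂ u _) x₀ x₁ x₂]
  -- Step B/C: the change of variables and the Fourier decay
  have hdec := hD.norm_oscInt_le_of_fourier_decay (c := invTwoPiCube) (n := n) (σ := σ) (n₀ := n₀) (n₁ := n₁)
    (n₂ := n₂) hK x₀ x₁ x₂
  refine hdec.trans ?_
  -- numerics
  set S : ℝ := (4 : ℝ) ^ (-(n : ℤ)) * |x₀| + (4 : ℝ) ^ (-(n : ℤ)) * |x₁| + (2 : ℝ) ^ (-(n : ℤ)) * |x₂| with hS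
  set y : MomSpace := WithLp.toLp 2 ![(4 : ℝ) ^ (-(n : ℤ)) * (x₀ / (2 * π)), (4 : ℝ) ^ (-(n : ℤ)) * (x₁ / (2 * π)),
    (2 : ℝ) ^ (-(n : ℤ)) * (x₂ / (2 * π))] with hy
  have hS0 : 0 ≤ S := by positivity
  have hden : 0 < 1 + S ^ N := by positivity
  have hyN : 0 < (1 + ‖y‖) ^ N := by positivity
  have hcmp : 1 + S ^ N ≤ (1 + (6 * π) ^ N) * (1 + ‖y‖) ^ N := one_add_pow_le n N x₀ x₁ x₂
  have hscale := det_mul_scaleFactor n n₀ n₁ n₂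
  set P : ℝ := (4 : ℝ) ^ (-((n : ℝ) * (3 / 2 + (n₀ : ℝ) + (n₁ : ℝ) + (n₂ : ℝ) / 2))) with hP
  have hP0 : 0 < P := Real.rpow_pos_of_pos (by norm_num) _
  -- rewrite the left-hand side as `(2^N c3 Bs vol) * P * ((1+‖y‖)^N)⁻¹`
  have hlhs : (4 : ℝ) ^ (-(n : ℤ)) * (4 : ℝ) ^ (-(n : ℤ)) * (2 : ℝ) ^ (-(n : ℤ)) *
      (2 ^ N * (c3 * (scaleFactor n n₀ n₁ n₂ * Bs) * vol) * ((1 + ‖y‖) ^ N)⁻¹) =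
      2 ^ N * (c3 * Bs * vol) * P * ((1 + ‖y‖) ^ N)⁻¹ := by
    rw [← hscale]; ring
  rw [hlhs]
  -- compare the denominators
  have hinv : ((1 + ‖y‖) ^ N)⁻¹ ≤ (1 + (6 * π) ^ N) / (1 + S ^ N) := by
    rw [inv_le_iff_one_le_mul₀ hyN, div_mul_eq_mul_div, one_le_div hden]
    linarith
  have hA0 : 0 ≤ 2 ^ N * (c3 * Bs * vol) * P := by positivity
  calc 2 ^ N * (c3 * Bs * vol) * P * ((1 + ‖y‖) ^ N)⁻¹
      ≤ 2 ^ N * (c3 * Bs * vol) * P * ((1 + (6 * π) ^ N) / (1 + S ^ N)) :=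
        mul_le_mul_of_nonneg_left hinv hA0
    _ = C₀ * P / (1 + S ^ N) := by rw [hC₀]; ring
    _ ≤ (C₀ + 1) * P / (1 + S ^ N) := by
        refine div_le_div_of_nonneg_right ?_ hden.le
        exact mul_le_mul_of_nonneg_right (by linarith) hP0.le

end BGM2003

end Literature.MathematicalPhysics.QuantumLattice.FermiRG

end
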